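import Summits.CriticalPhenomena.PercolationContinuityZ3.Theorems.Transplant.FKConnectivityAllQAntipodalTwoSpineAssembly
import HarnessLib

/-!
# `C_∞` FOR THE MAJORITY TYPE AT `|supp f| = 3` — the first consumer of Conjecture U¹¹ (`FK.apUpcSplit_nonneg_of_isTTSP`)

Theorem file (`--supports stmt-CriticalPhenomena-4575`), FK sub-lane `prim-bschramm-fk-2` (gen 17); builds on p205010 (kernel
theorem, internal audit signed; external expert review pending).  No named facts, no sorries, standard axioms.

Gen 10's Conjecture `C_∞` (memo `bschramm/FROM-fk-2-g10-THRESHOLD-NA.md`; FK-Q2.md §19–20) says that for a series–parallel graph `H`,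
`0 < q ≤ 1`, and increasing `f, g` reading disjoint edge sets, the antipodal covariance form
`apPsi q H f g = ∑_{γ ⊆ H} q^{k(γ)+k(H∖γ)} (f γ - f(H∖γ)) (g γ - g(H∖γ))` (twice the square-free top coefficient of
`Z_H(z)² · Cov_{φ_{z,q}}(f, g)` in the edge odds `z`) is `≤ 0`.  Gen 11 proved it for `|supp f| ≤ 2` (Theorem U,
`FK.apPsi_edge_nonpos_of_isTTSP`, `FK.apPsi_two_edges_nonpos_of_isTTSP`) and showed (memo `FROM-fk-2-g11-ANTIPODAL-UPC.md` §3.1, §3.6)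
that at `|supp f| = 3` the cone of odd increments `F_f = f - f∘(H∖·)` has the five extreme rays `F_x, F_y, F_z, F_maj, F_and`, with the
pointwise identity `F_maj = ½ (F_y + F_z) + F_x · 1{γ splits {y,z}}`; so `C_∞(maj₃)` follows from Theorem U at `y`, at `z`, and the
SPLIT one-edge inequality at `x` — which is gen 11's Conjecture U¹¹, now the theorem `FK.apUpcSplit_nonneg_of_isTTSP` (gen 15–16,
`…TwoSpineAssembly`).  This file types that deduction:
* `FK.apPsi_edge_split_eq` — the split one-edge identity `q · apPsi q (E ∪ {x}) 1_x (split_{yz} · g) = 2 (q - 1) · apUpcSplit q E s t y z g`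
  (`x = st ∉ E`, `y, z ∈ E`; it is `FK.apPsi_edge_eq` against the test function `split_{yz} · g`);
* `FK.apPsi_edge_split_nonpos_of_isTTSP` — hence `≤ 0` for `0 < q ≤ 1` on a two-terminal series–parallel `E` (U¹¹);
* `FK.apPsi_mem_edge_nonpos_of_isTTSP` — Theorem U at an INNER edge `y ∈ E` of `E ∪ {st}` (re-rooting, `FK.IsTTSP.reroot`);
* `FK.apPsi_maj3_eq` — the pointwise decomposition of the majority form;
* **`FK.apPsi_maj3_nonpos_of_isTTSP`** — `E` TTSP between `s, t`, `x = st ∉ E`, `y ≠ z ∈ E`, `0 < q ≤ 1`, `g` monotone on the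
  sub-configurations of `E ∪ {x}` reading none of `x, y, z` ⟹ `apPsi q (E ∪ {x}) maj_{x,y,z} g ≤ 0`: every square-free top coefficient of
  `Z² Cov_{φ_{z,q}}(maj(ω_x, ω_y, ω_z), g)` on a series–parallel graph presented from `x` is `≤ 0` — Conjecture `C_∞` for the majority type.
The remaining level-3 type is `and₃` (`∑_{ω ⊇ {x,y,z}} q^{k(ω)+k(H∖ω)} (g(ω) - g(H∖ω)) ≤ 0`), not a consequence of U and U¹¹ (memo g11 §3.6–3.7).
[cite: Grimmett2006, §1.4 eq. (1.20) (p. 15); §3.8 Thm. (3.90) (pp. 61–62); §3.9 (pp. 63–64)] [cite: Wagner2006, Thm. 5.8(d), §5.3]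
-/

noncomputable section

namespace Summit.CriticalPhenomena.PercolationContinuityZ3.Theorems

namespace FK

open Literature.Probability.LatticeModels Literature.Probability.Percolation
open scoped Classical

variable {V : Type*}

/-- The split indicator does not read an edge other than the two marked ones. [folklore] -/
theorem splitInd_insert_of_ne {x y z : Sym2 V} (hxy : x ≠ y) (hxz : x ≠ z) (A : Finset (Sym2 V)) :
    splitInd y z (insert x A) = splitInd y z A := by
  unfold splitInd
  simp only [Finset.mem_insert, hxy.symm, hxz.symm, false_or]

section Maj

variable [Fintype V] {s t : V}

omit [Fintype V] in
/-- The one-edge antipodal covariance form against `split_{yz} · g`, written out: for `y, z ∈ H` the split indicator is the same on both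
members of a complementary pair, so `apPsi q H 1_x (split_{yz} · g) = ∑_{γ ⊆ H, |γ ∩ {y,z}| = 1} q^{k(γ)+k(H∖γ)} (1_x(γ) - 1_x(H∖γ)) (g γ - g(H∖γ))`
— the one-edge form RESTRICTED to the complementary pairs that split `{y, z}`. [folklore] -/
theorem apPsi_splitInd_mul_eq (q : ℝ) {H : Finset (Sym2 V)} {x y z : Sym2 V} (hy : y ∈ H) (hz : z ∈ H) (g : Finset (Sym2 V) → ℝ) :
    apPsi q H (fun A => if x ∈ A then 1 else 0) (fun A => splitInd y z A * g A) =
      ∑ γ ∈ H.powerset, q ^ apExp H γ * (splitInd y z γ *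
        (((if x ∈ γ then (1 : ℝ) else 0) - (if x ∈ H \ γ then 1 else 0)) * (g γ - g (H \ γ)))) := by
  unfold apPsi
  refine Finset.sum_congr rfl fun γ _ => ?_
  dsimp only
  rw [TwoSpine.splitInd_compl hy hz]
  ring

/-- **The split one-edge identity**: for `x = st ∉ E`, `y, z ∈ E` and `g` not reading `x`,
`q · apPsi q (E ∪ {x}) 1_x (split_{yz} · g) = 2 (q - 1) · apUpcSplit q E s t y z g` — `FK.apPsi_edge_eq` against the test function
`split_{yz} · g` (which does not read `x` either), and `apUpcSplit = apUpc ∘ (split_{yz} · )` (`FK.apUpcSplit_eq_apUpc`).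
[cite: Grimmett2006, §1.4 eq. (1.20) (p. 15); Thm. (3.1)(a)] -/
theorem apPsi_edge_split_eq (q : ℝ) {E : Finset (Sym2 V)} (hst : s(s, t) ∉ E) {y z : Sym2 V} (hy : y ∈ E) (hz : z ∈ E)
    {g : Finset (Sym2 V) → ℝ} (hg : ∀ A : Finset (Sym2 V), g (insert s(s, t) A) = g A) :
    q * apPsi q (insert s(s, t) E) (fun A => if s(s, t) ∈ A then 1 else 0) (fun A => splitInd y z A * g A) =
      2 * (q - 1) * apUpcSplit q E s t y z g := by
  have hxy : s(s, t) ≠ y := fun h => hst (h ▸ hy)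
  have hxz : s(s, t) ≠ z := fun h => hst (h ▸ hz)
  rw [apUpcSplit_eq_apUpc]
  exact apPsi_edge_eq q hst fun A =>
    show splitInd y z (insert s(s, t) A) * g (insert s(s, t) A) = splitInd y z A * g A by
      rw [splitInd_insert_of_ne hxy hxz, hg]

/-- **The split one-edge inequality (`0 < q ≤ 1`) = Conjecture U¹¹**: `E` two-terminal series–parallel between `s, t`, `x = st ∉ E`,
`y ≠ z ∈ E`, `g` monotone on the sub-configurations of `E` reading none of `x, y, z` ⟹
`apPsi q (E ∪ {x}) 1_x (split_{yz} · g) = ∑_{γ splits {y,z}} q^{k+k̄} (1_x(γ) - 1_x(γᶜ)) (g γ - g γᶜ) ≤ 0` — by `FK.apPsi_edge_split_eq` and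
`FK.apUpcSplit_nonneg_of_isTTSP`.  In the drift notation of memo g11 §3.6 (`a_ε = ∑_{ω ∩ {x,y,z} = ε} q^{k+k̄} (g ω - g ωᶜ)`) this is
`a_{xy} + a_{xz} ≤ 0`. [cite: Grimmett2006, §3.8 Thm. (3.90) (pp. 61–62); §3.9 (pp. 63–64)] -/
theorem apPsi_edge_split_nonpos_of_isTTSP {q : ℝ} (hq0 : 0 < q) (hq1 : q ≤ 1) {E : Finset (Sym2 V)} (hE : IsTTSP E s t)
    (hst : s(s, t) ∉ E) {y z : Sym2 V} (hy : y ∈ E) (hz : z ∈ E) (hyz : y ≠ z) {g : Finset (Sym2 V) → ℝ}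
    (hgx : ∀ A : Finset (Sym2 V), g (insert s(s, t) A) = g A) (hgy : ∀ A : Finset (Sym2 V), g (insert y A) = g A)
    (hgz : ∀ A : Finset (Sym2 V), g (insert z A) = g A)
    (hmono : ∀ ⦃A B : Finset (Sym2 V)⦄, A ⊆ B → B ⊆ E → g A ≤ g B) :
    apPsi q (insert s(s, t) E) (fun A => if s(s, t) ∈ A then 1 else 0) (fun A => splitInd y z A * g A) ≤ 0 := by
  have key := apPsi_edge_split_eq q hst hy hz hgx
  have hU := apUpcSplit_nonneg_of_isTTSP hq0 hq1 hE hy hz hyz hmono hgy hgz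
  have h2 : q * apPsi q (insert s(s, t) E) (fun A => if s(s, t) ∈ A then 1 else 0) (fun A => splitInd y z A * g A) ≤ 0 := by
    rw [key]; nlinarith
  nlinarith

/-- **Theorem U at an inner edge**: `E` two-terminal series–parallel between `s, t`, `st ∉ E`, `y ∈ E`, `0 < q ≤ 1`, `g` monotone on the
sub-configurations of `E ∪ {st}` not reading `y` ⟹ `apPsi q (E ∪ {st}) 1_y g ≤ 0`: the network `(E ∪ {st}) ∖ {y}` is a sub-network of
`E ∪ {st}`, two-terminal series–parallel between the ends of `y` by re-rooting (`FK.IsTTSP.reroot`), so `FK.apPsi_edge_nonpos_of_isTTSP`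
applies. [cite: Grimmett2006, §3.8 Thm. (3.90) (pp. 61–62); §3.9 (pp. 63–64)] [cite: Wagner2006, Thm. 5.8(d), §5.3] -/
theorem apPsi_mem_edge_nonpos_of_isTTSP {q : ℝ} (hq0 : 0 < q) (hq1 : q ≤ 1) {E : Finset (Sym2 V)} (hE : IsTTSP E s t)
    (hst : s(s, t) ∉ E) {y : Sym2 V} (hy : y ∈ E) {g : Finset (Sym2 V) → ℝ} (hgy : ∀ A : Finset (Sym2 V), g (insert y A) = g A)
    (hmono : ∀ ⦃A B : Finset (Sym2 V)⦄, A ⊆ B → B ⊆ insert s(s, t) E → g A ≤ g B) :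
    apPsi q (insert s(s, t) E) (fun A => if y ∈ A then 1 else 0) g ≤ 0 := by
  induction y using Sym2.ind with
  | h u v =>
    -- re-root `E ∪ {st}` at `y = uv`
    have hR : IsTTSP (E ∪ {s(s, t)}) u v :=
      hE.reroot (IsTTSP.edge hE.ne) (Finset.disjoint_singleton_right.2 hst) (fun w _ hw => by
        obtain ⟨e, he, hwe⟩ := hw
        rw [Finset.mem_singleton] at he; subst he
        exact Sym2.mem_iff.1 hwe) hy
    set M := (insert s(s, t) E).erase s(u, v) with hM
    have hMsub : M ⊆ E ∪ {s(s, t)} := by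
      rw [hM, Finset.union_comm, ← Finset.insert_eq]; exact Finset.erase_subset _ _
    have hyM : s(u, v) ∉ M := Finset.notMem_erase _ _
    have hins : insert s(u, v) M = insert s(s, t) E := Finset.insert_erase (Finset.mem_insert_of_mem hy)
    rw [← hins]
    exact apPsi_edge_nonpos_of_isTTSP hq0 hq1 hR hMsub hyM hgy fun A B hAB hB =>
      hmono hAB (hB.trans (hins ▸ Finset.subset_insert _ _))

omit [Fintype V] in
/-- **The majority form decomposes**: for `x, y, z ∈ H` and any `g`,
`apPsi q H maj_{x,y,z} g = ½ (apPsi q H 1_y g + apPsi q H 1_z g) + apPsi q H 1_x (split_{yz} · g)` — the pointwise identity of odd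
increments `F_maj = ½ (F_y + F_z) + F_x · 1{γ splits {y,z}}` (memo g11 §3.6: `maj₃ = ½ (U_y + U_z) + U¹¹_x`), checked on the eight
patterns `γ ∩ {x,y,z}`. [folklore] -/
theorem apPsi_maj3_eq (q : ℝ) {H : Finset (Sym2 V)} {x y z : Sym2 V} (hx : x ∈ H) (hy : y ∈ H) (hz : z ∈ H)
    (g : Finset (Sym2 V) → ℝ) :
    apPsi q H (fun A => if (x ∈ A ∧ y ∈ A) ∨ (x ∈ A ∧ z ∈ A) ∨ (y ∈ A ∧ z ∈ A) then 1 else 0) g =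
      (apPsi q H (fun A => if y ∈ A then 1 else 0) g + apPsi q H (fun A => if z ∈ A then 1 else 0) g) / 2 +
        apPsi q H (fun A => if x ∈ A then 1 else 0) (fun A => splitInd y z A * g A) := by
  unfold apPsi
  rw [← Finset.sum_add_distrib, Finset.sum_div, ← Finset.sum_add_distrib]
  refine Finset.sum_congr rfl fun γ _ => ?_
  have hxc : x ∈ H \ γ ↔ x ∉ γ := by rw [Finset.mem_sdiff]; exact ⟨fun h => h.2, fun h => ⟨hx, h⟩⟩
  have hyc : y ∈ H \ γ ↔ y ∉ γ := by rw [Finset.mem_sdiff]; exact ⟨fun h => h.2, fun h => ⟨hy, h⟩⟩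
  have hzc : z ∈ H \ γ ↔ z ∉ γ := by rw [Finset.mem_sdiff]; exact ⟨fun h => h.2, fun h => ⟨hz, h⟩⟩
  dsimp only
  rw [TwoSpine.splitInd_compl hy hz]
  unfold splitInd
  simp only [hxc, hyc, hzc]
  by_cases a : x ∈ γ <;> by_cases b : y ∈ γ <;> by_cases c : z ∈ γ <;>
  simp only [a, b, c, and_self, and_true, and_false, or_self, or_true, or_false,
    if_true, if_false, not_true_eq_false, not_false_eq_true, iff_true, iff_false] <;> ring

/-- **`C_∞` FOR THE MAJORITY TYPE (`0 < q ≤ 1`).**  `E` two-terminal series–parallel between `s, t`, `x = st ∉ E`, `y ≠ z ∈ E`,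
`0 < q ≤ 1`, `g` monotone on the sub-configurations of `E ∪ {x}` reading none of `x, y, z` ⟹
`apPsi q (E ∪ {x}) maj(1_x, 1_y, 1_z) g = ∑_{γ ⊆ E ∪ {x}} q^{k(γ)+k(γᶜ)} (maj(γ) - maj(γᶜ)) (g γ - g γᶜ) ≤ 0` — every square-free top
coefficient of `Z² · Cov_{φ_{z,q}}(maj(ω_x, ω_y, ω_z), g)` on a series–parallel graph presented from the edge `x` is `≤ 0`.  Proof:
`FK.apPsi_maj3_eq` + Theorem U at `y` and at `z` (`FK.apPsi_mem_edge_nonpos_of_isTTSP`) + Conjecture U¹¹ at `x`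
(`FK.apPsi_edge_split_nonpos_of_isTTSP`).  With `FK.apPsi_edge_nonpos_of_isTTSP` / `FK.apPsi_two_edges_nonpos_of_isTTSP` (and the cone
of odd increments at `|supp f| = 3`, memo g11 §3.1) this leaves `and₃` as the only open type of Conjecture `C_∞` at `|supp f| ≤ 3`.
[cite: Grimmett2006, §1.4 eq. (1.20) (p. 15); §3.8 Thm. (3.90) (pp. 61–62); §3.9 (pp. 63–64)] [cite: Wagner2006, Thm. 5.8(d), §5.3] -/
theorem apPsi_maj3_nonpos_of_isTTSP {q : ℝ} (hq0 : 0 < q) (hq1 : q ≤ 1) {E : Finset (Sym2 V)} (hE : IsTTSP E s t)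
    (hst : s(s, t) ∉ E) {y z : Sym2 V} (hy : y ∈ E) (hz : z ∈ E) (hyz : y ≠ z) {g : Finset (Sym2 V) → ℝ}
    (hgx : ∀ A : Finset (Sym2 V), g (insert s(s, t) A) = g A) (hgy : ∀ A : Finset (Sym2 V), g (insert y A) = g A)
    (hgz : ∀ A : Finset (Sym2 V), g (insert z A) = g A)
    (hmono : ∀ ⦃A B : Finset (Sym2 V)⦄, A ⊆ B → B ⊆ insert s(s, t) E → g A ≤ g B) :
    apPsi q (insert s(s, t) E)
        (fun A => if (s(s, t) ∈ A ∧ y ∈ A) ∨ (s(s, t) ∈ A ∧ z ∈ A) ∨ (y ∈ A ∧ z ∈ A) then 1 else 0) g ≤ 0 := by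
  rw [apPsi_maj3_eq q (Finset.mem_insert_self _ _) (Finset.mem_insert_of_mem hy) (Finset.mem_insert_of_mem hz)]
  have hY := apPsi_mem_edge_nonpos_of_isTTSP hq0 hq1 hE hst hy hgy hmono
  have hZ := apPsi_mem_edge_nonpos_of_isTTSP hq0 hq1 hE hst hz hgz hmono
  have hX := apPsi_edge_split_nonpos_of_isTTSP hq0 hq1 hE hst hy hz hyz hgx hgy hgz fun A B hAB hB =>
    hmono hAB (hB.trans (Finset.subset_insert _ _))
  linarith

end Maj

end FK

end Summit.CriticalPhenomena.PercolationContinuityZ3.Theorems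

end
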